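/-
Copyright: statement-level skeleton of a published paper (lit-balaban cell, Phase-2 proof seat p39 gen 10). No proof claims
beyond what the kernel checks below.
-/
import Literature.MathematicalPhysics.QuantumFieldTheory.Balaban1983to89.B3Eq338LkerBounds

/-!
# B3 — T. Bałaban, *(Higgs)₂,₃ quantum fields in a finite volume. III. Renormalization*, CMP **88** (1983) 411–445
[Balaban1983Higgs3], p. 444 [PDF 34], the replacement sentence for the triangle factor of the graphs **(2.20)** and **(3.38)**,
ON THE PRINTED INFINITE LATTICE ξℤ³: *"Now we replace the propagators G^η_{j₀}(0), G^η_{j₀} by C^ξ in the way described several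
times. We get a convergent expression plus Σ_{y,y″}ξ^{2d}Γ″_μ(y,y′,y″) defined with the help of the propagator C^ξ. … Finally for the
graphs (2.20) it equals [(3.38)] = 0, because the functions which we are summing are odd."*

statement-level skeleton of published theorems with citation tags; proofs where landed; nothing here is a claim about
the Yang–Mills mass gap

PDF held: `paper:balaban1983-higgs-2-3-quantum-fields-finite-volume` (journal page = PDF page + 410); p. 444 [PDF 34] read on the
×2 render `run/shared/lean/pub/pub-balaban/b2b-balaban-ref1/pages/1983-cmp88-higgs23-III/1983-cmp88-higgs23-III-p034-x2.png`.
Row **B3.Eq3.33-3.38** of `HOME/lit-balaban-r15/ROWS-B3.md` (fold owner r15).  THIS FILE is the assembly of the p39 gen-10 (2.20)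
programme: `B3Eq338KernelForm` (the three-slot factor `tri20` = r15's `lhs338` on convolution kernels, `= 0` for `C^ξ` by r15's
(3.38) chain; the summation-by-parts form `sbpForm`) and `B3Eq338LkerBounds` (the inner line sum `L` is bounded as soon as one line
carries `M = G − C^ξ`, and has a propagator law when both lines are propagators).  As for Π_{μμ′}, Π_{μμ′ν} (gens 7–9) and for the
graphs (2.19) (`B3Eq337ZeroLattice`), the three lines of the triangle (2.20) carry the infinite-lattice propagators of p. 433 — the two
scalar lines `G_{j₀}(0)` with parameters `(a, m²)`, the vector line `G_{j₀}` with its own `(a₃, m₃²)` (MODEL INSTANCE: both read as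
p03's `GkLat` rescaled, `B3Eq316ResolventZeroLattice.GxiL`) — and `G = C^ξ + M` splits the factor into the pure-`C^ξ` term (3.38),
which is `0`, plus three groups of terms with the difference kernel on the first, the middle or the last line, each bounded
UNIFORMLY in the spacing: the factor is of degree 0 and each printed product alone is only logarithmically bounded, but after the
two summations by parts of `B3Eq338KernelForm` every group is a composition of once-differentiated propagator laws with one
bounded (`M`-type) line.
WHAT IS PROVED (`ξ = L^{−k} = xiOf ℓ k`, `G = G^ξ_k(0)` with `(a,m²)`, `G₃` with `(a₃,m₃²)`, `C = (p,q) ↦ C^ξ(p−q)`; `d = 3`):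
* §1 the kernel laws at the instance in the shape of `B3Eq338LkerBounds`: `GxiL_eq_add_M` (`G = Cv + M` for the convolution
  kernel `Cv` of `C^ξ`, kept as a variable with its defining equation so that every kernel slot stays first-order),
  `sbp_hypotheses_G`, `laws_conv`, `sbp_hypotheses_conv` (the summability hypotheses of the summation-by-parts form for the triples
  `(G,G,G₃)` and `(Cv,Cv,Cv)` — hence `T = sbpForm` for both, by `B3Eq338KernelForm.tri20_eq_sbpForm`).
* §2 the three groups: `group1_bound` (`M` on the first line — gen 9's transposed Fubini bound at rate δ/2 against the propagator
  law of `L[G,G₃] + L[G,G₃](·−e_μ)`), `group2_bound` (`M` on the middle line — `|L[M,G₃]| ≤ const`), `group3_bound` (`M` on the last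
  line — `|L[Cv,M₃]| ≤ const`), and the pointwise split `integrand_split` (model-free).
* §3 `sbpForm_sub_bound` (the core estimate at fixed `k` and laws: `|sbpForm[G,G,G₃] − sbpForm[Cv,Cv,Cv]| ≤ 3(O₁+O₂+O₃)|q³|`) and
  **`exists_tri20_bound`** — for `L = ℓ+1 ≥ 2` and a window `[a₋,a₊] × [0,m²₊]` (`a₋ > 0`) there is `Cst > 0` such that for every
  `k ≥ 1`, all `(a,m²), (a₃,m₃²)` in the window, all `q³`, `μ`, `y′`: (i) `T[G,G,G₃] = sbpForm[G,G,G₃]` (all series converge);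
  (ii) **`|T[G,G,G₃](y′) − T[C^ξ,C^ξ,C^ξ](y′)| ≤ Cst·|q³|`** (*"a convergent expression"*); (iii) `T[C^ξ,C^ξ,C^ξ](y′) = 0` ((3.38));
  (iv) **`|T[G,G,G₃](y′)| ≤ Cst·|q³|`** — the coefficient of the local vertex (3.36) for the graphs (2.20) is bounded uniformly in the
  spacing and the position.
HONEST SCOPE: zero external field, `d = 3`, the printed infinite lattice; all three lines are zero-field scalar-type lattice
propagators `(−Δ^ξ + m² + aP)^{−1}` (the vector line `G_{j₀}` read this way, as in the row's other proved members); constants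
existential, uniform in `k ≥ 1` and the window; the counterterm graphs (2.21) and the pictures (3.35) are not treated.  Mathlib +
the cited tree files only; theorems only, no definitions, no named facts; standard axioms.  Unit `lit-balaban-p39-g10` (Phase-2
proof seat p39, gen 10), HOME `run/shared/lean/pub/lit-balaban/`, 2026-08-22.
-/

open scoped BigOperators
open Finset Filter Topology

namespace Literature.MathematicalPhysics.QuantumFieldTheory.Balaban1983to89.B3Eq338ZeroLattice

open B3Sect3VectorSelfEnergy B3CxiUniformBound B3ZdLatticeProfileSums B3ZdKernelConvolutions B3Eq316ResolventZeroLattice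
  B3Eq316DifferenceKernelBounds B3Eq338KernelForm B3Eq338LkerBounds
open B3CxiLatticePairSums (supNorm_unitVec abs_d2Z_Cxi_le_crude)

noncomputable section

variable {ℓ k : ℕ} {a m2 a₃ m₃ : ℝ}

/-! ## §1 The laws at the instance and the summation-by-parts form for `(G,G,G₃)` and `(C,C,C)` -/

section Laws

/-- kernel: `G^ξ_k(0) = C^ξ + M` as two-variable kernels (the definition of `MxiL`), for the convolution kernel `Cv` of `C^ξ` (kept as
a variable with its defining equation, so that all kernel slots stay first-order). [cite: Balaban1983Higgs3, (3.16) p.437] -/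
theorem GxiL_eq_add_M {Cv : ZSite 3 → ZSite 3 → ℝ} (hCv : Cv = fun p q => Cxi 3 (xiOf ℓ k) (p - q)) (a m2 : ℝ) :
    GxiL ℓ k a m2 = fun p q => Cv p q + MxiL ℓ k a m2 p q := by
  subst hCv; funext p q; unfold MxiL; ring

/-- kernel: a first-order profile bound is at most `Cξ^{−1}` (`P₁ ≤ ξ^{−1}`). [cite: Balaban1983Higgs3, (3.16) p.437] -/
theorem le_mul_inv_of_le_prof_one {ξ δ C t : ℝ} (hξ : 0 < ξ) (hδ : 0 ≤ δ) (hC : 0 ≤ C) {u : ZSite 3}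
    (h : t ≤ C * prof ξ δ 1 u) : t ≤ C * ξ⁻¹ := by
  refine h.trans (mul_le_mul_of_nonneg_left ?_ hC)
  have : prof ξ δ 1 u ≤ (ξ ^ 1)⁻¹ := profile_le_inv_pow hξ hδ 1 u
  rwa [pow_one] at this

/-- **The summability hypotheses of the summation-by-parts form for the triple `(G, G, G₃)`** (the laws of p. 437 at the instance:
`|∂G| ≤ CP₂`, `|∂G∂^*| ≤ CP₃ ≤ Cξ^{−1}P₂`, `|G₃| ≤ CP₁ ≤ Cξ^{−1}`) — hence `T[G,G,G₃] = sbpForm[G,G,G₃]`. [cite: Balaban1983Higgs3, (3.38) p.444] -/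
theorem sbp_hypotheses_G {δ C : ℝ} (hδ : 0 < δ) (hδ1 : δ ≤ 1) (hC : 0 ≤ C)
    (l2 : ∀ (μ : Fin 3) (y z : ZSite 3), |dK1 (xiOf ℓ k) μ (GxiL ℓ k a m2) y z| ≤ C * prof (xiOf ℓ k) δ 2 (y - z))
    (l3 : ∀ (μ : Fin 3) (y z : ZSite 3), |dK2 (xiOf ℓ k) μ (GxiL ℓ k a m2) y z| ≤ C * prof (xiOf ℓ k) δ 2 (y - z))
    (l4 : ∀ (μ' μ : Fin 3) (x y : ZSite 3), |d2K (xiOf ℓ k) μ' μ (GxiL ℓ k a m2) x y| ≤ C * prof (xiOf ℓ k) δ 3 (x - y))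
    (g1 : ∀ y z : ZSite 3, |GxiL ℓ k a₃ m₃ y z| ≤ C * prof (xiOf ℓ k) δ 1 (y - z)) (μ : Fin 3) (y' : ZSite 3) :
    (∀ (ν : Fin 3) (x : ZSite 3), Summable fun w =>
        (xiOf ℓ k) ^ 3 * (d2K (xiOf ℓ k) μ ν (GxiL ℓ k a m2) x w * GxiL ℓ k a₃ m₃ y' w)) ∧
    (∀ (ν : Fin 3) (x : ZSite 3), Summable fun w =>
        (xiOf ℓ k) ^ 3 * (dK2 (xiOf ℓ k) ν (GxiL ℓ k a m2) x w * GxiL ℓ k a₃ m₃ y' w)) ∧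
    (∀ ν : Fin 3, Summable fun y => (xiOf ℓ k) ^ 3 *
        (dK1 (xiOf ℓ k) ν (GxiL ℓ k a m2) y' y * Lker (xiOf ℓ k) μ ν (GxiL ℓ k a m2) (GxiL ℓ k a₃ m₃) y' y)) ∧
    (∀ ν : Fin 3, Summable fun y => dK1 (xiOf ℓ k) ν (GxiL ℓ k a m2) y' (y + unitVec μ) *
        Nker (xiOf ℓ k) ν (GxiL ℓ k a m2) (GxiL ℓ k a₃ m₃) y' y) ∧
    (∀ ν : Fin 3, Summable fun y => dK1 (xiOf ℓ k) ν (GxiL ℓ k a m2) y' y *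
        Nker (xiOf ℓ k) ν (GxiL ℓ k a m2) (GxiL ℓ k a₃ m₃) y' y) := by
  have hξ := xiOf_pos ℓ k
  have hξ1 := xiOf_le_one ℓ k
  set ξ := xiOf ℓ k with hξdef
  have hinv : 1 ≤ ξ⁻¹ := one_le_inv_iff₀.2 ⟨hξ, hξ1⟩
  have h2 : ∀ (ν : Fin 3) (x w : ZSite 3), |d2K ξ μ ν (GxiL ℓ k a m2) x w| ≤ C * ξ⁻¹ * prof ξ δ 2 (x - w) := by
    intro ν x w
    refine (l4 μ ν x w).trans ?_
    rw [mul_assoc]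
    exact mul_le_mul_of_nonneg_left (prof_succ_le hξ δ 2 (x - w)) hC
  have h2' : ∀ (ν : Fin 3) (x w : ZSite 3), |dK2 ξ ν (GxiL ℓ k a m2) x w| ≤ C * ξ⁻¹ * prof ξ δ 2 (x - w) := by
    intro ν x w
    refine (l3 ν x w).trans ?_
    have hp := prof_nonneg hξ.le δ 2 (x - w)
    calc C * prof ξ δ 2 (x - w) = C * 1 * prof ξ δ 2 (x - w) := by ring
      _ ≤ C * ξ⁻¹ * prof ξ δ 2 (x - w) := by gcongr
  have h3 : ∀ w, |GxiL ℓ k a₃ m₃ y' w| ≤ C * ξ⁻¹ := fun w => le_mul_inv_of_le_prof_one hξ hδ.le hC (g1 y' w)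
  exact sbp_hypotheses_of_laws hξ hξ1 hδ hδ1 (K₁ := GxiL ℓ k a m2) (K₂ := GxiL ℓ k a m2) (K₃ := GxiL ℓ k a₃ m₃)
    (μ := μ) (y' := y') (A₁ := C) (A₂ := C * ξ⁻¹) (B := C * ξ⁻¹) hC (by positivity) (by positivity)
    (fun ν y => l2 ν y' y) h2 h2' h3

/-- **The laws of the convolution kernel `Cv` of `C^ξ`** in kernel form: `|∂_νCv| ≤ CP₂`, `|∂_μCv∂^*_ν| ≤ (11700 + C)ξ^{−1}P₂`
(gen 8's `abs_d2Z_Cxi_le_crude`, `P₂^{1/2} ≤ P₂^δ` for `δ ≤ 1/2`), `|Cv∂^*_ν| ≤ (11700 + C)ξ^{−1}P₂`, `|Cv| ≤ CP₁ ≤ Cξ^{−1}`.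
[cite: Balaban1983Higgs3, (3.16) p.437] -/
theorem laws_conv {δ C : ℝ} (hδ : 0 < δ) (hδh : δ ≤ 1 / 2) (hC : 0 ≤ C)
    (l7 : ∀ u : ZSite 3, |Cxi 3 (xiOf ℓ k) u| ≤ C * prof (xiOf ℓ k) δ 1 u)
    (l8 : ∀ (μ : Fin 3) (u : ZSite 3), |pdiffAdjZ (xiOf ℓ k)⁻¹ μ (Cxi 3 (xiOf ℓ k)) u| ≤ C * prof (xiOf ℓ k) δ 2 u)
    (l9 : ∀ (μ : Fin 3) (u : ZSite 3), |pdiffZ (xiOf ℓ k)⁻¹ μ (Cxi 3 (xiOf ℓ k)) u| ≤ C * prof (xiOf ℓ k) δ 2 u)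
    {Cv : ZSite 3 → ZSite 3 → ℝ} (hCv : Cv = fun p q => Cxi 3 (xiOf ℓ k) (p - q)) :
    (∀ (ν : Fin 3) (x y : ZSite 3), |dK1 (xiOf ℓ k) ν Cv x y| ≤ C * prof (xiOf ℓ k) δ 2 (x - y)) ∧
    (∀ (μ ν : Fin 3) (x w : ZSite 3),
      |d2K (xiOf ℓ k) μ ν Cv x w| ≤ (11700 + C) * (xiOf ℓ k)⁻¹ * prof (xiOf ℓ k) δ 2 (x - w)) ∧
    (∀ (ν : Fin 3) (x w : ZSite 3), |dK2 (xiOf ℓ k) ν Cv x w| ≤ (11700 + C) * (xiOf ℓ k)⁻¹ * prof (xiOf ℓ k) δ 2 (x - w)) ∧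
    (∀ x w : ZSite 3, |Cv x w| ≤ C * prof (xiOf ℓ k) δ 1 (x - w)) ∧
    (∀ x w : ZSite 3, |Cv x w| ≤ C * (xiOf ℓ k)⁻¹) := by
  have hξ := xiOf_pos ℓ k
  have hξ1 := xiOf_le_one ℓ k
  -- `|∂∂^*C^ξ| ≤ 11700 ξ^{−1} P₂^{1/2}` (gen 8), read as a profile of rate `1/2`
  have hd2 : ∀ (μ ν : Fin 3) (u : ZSite 3),
      |pdiffZ (xiOf ℓ k)⁻¹ μ (pdiffAdjZ (xiOf ℓ k)⁻¹ ν (Cxi 3 (xiOf ℓ k))) u| ≤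
        11700 * (xiOf ℓ k)⁻¹ * prof (xiOf ℓ k) (1 / 2) 2 u :=
    fun μ ν u => abs_d2Z_Cxi_le_crude (d := 3) rfl hξ hξ1 μ ν u
  set ξ := xiOf ℓ k with hξdef
  subst hCv
  have hinv : 1 ≤ ξ⁻¹ := one_le_inv_iff₀.2 ⟨hξ, hξ1⟩
  refine ⟨fun ν x y => ?_, fun μ ν x w => ?_, fun ν x w => ?_, fun x w => ?_, fun x w => ?_⟩
  · rw [dK1_conv]; exact l9 ν (x - y)
  · rw [d2K_conv]
    refine (hd2 μ ν (x - w)).trans ?_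
    have hp := prof_nonneg hξ.le δ 2 (x - w)
    have hmono : prof ξ (1 / 2) 2 (x - w) ≤ prof ξ δ 2 (x - w) := prof_mono_rate hξ.le hδh 2 (x - w)
    calc 11700 * ξ⁻¹ * prof ξ (1 / 2) 2 (x - w) ≤ 11700 * ξ⁻¹ * prof ξ δ 2 (x - w) :=
          mul_le_mul_of_nonneg_left hmono (by positivity)
      _ ≤ (11700 + C) * ξ⁻¹ * prof ξ δ 2 (x - w) := by gcongr; linarith
  · rw [dK2_conv]
    refine (l8 ν (x - w)).trans ?_
    have hp := prof_nonneg hξ.le δ 2 (x - w)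
    calc C * prof ξ δ 2 (x - w) = C * 1 * prof ξ δ 2 (x - w) := by ring
      _ ≤ (11700 + C) * ξ⁻¹ * prof ξ δ 2 (x - w) := by gcongr; linarith
  · exact l7 (x - w)
  · exact le_mul_inv_of_le_prof_one hξ hδ.le hC (l7 (x - w))

/-- **The summability hypotheses of the summation-by-parts form for the pure-`C^ξ` triple** — hence `T[C^ξ,C^ξ,C^ξ] =
sbpForm[C^ξ,C^ξ,C^ξ]`. [cite: Balaban1983Higgs3, (3.38) p.444] -/
theorem sbp_hypotheses_conv {δ C : ℝ} (hδ : 0 < δ) (hδh : δ ≤ 1 / 2) (hC : 0 ≤ C)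
    (l7 : ∀ u : ZSite 3, |Cxi 3 (xiOf ℓ k) u| ≤ C * prof (xiOf ℓ k) δ 1 u)
    (l8 : ∀ (μ : Fin 3) (u : ZSite 3), |pdiffAdjZ (xiOf ℓ k)⁻¹ μ (Cxi 3 (xiOf ℓ k)) u| ≤ C * prof (xiOf ℓ k) δ 2 u)
    (l9 : ∀ (μ : Fin 3) (u : ZSite 3), |pdiffZ (xiOf ℓ k)⁻¹ μ (Cxi 3 (xiOf ℓ k)) u| ≤ C * prof (xiOf ℓ k) δ 2 u)
    {Cv : ZSite 3 → ZSite 3 → ℝ} (hCv : Cv = fun p q => Cxi 3 (xiOf ℓ k) (p - q)) (μ : Fin 3) (y' : ZSite 3) :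
    (∀ (ν : Fin 3) (x : ZSite 3), Summable fun w => (xiOf ℓ k) ^ 3 * (d2K (xiOf ℓ k) μ ν Cv x w * Cv y' w)) ∧
    (∀ (ν : Fin 3) (x : ZSite 3), Summable fun w => (xiOf ℓ k) ^ 3 * (dK2 (xiOf ℓ k) ν Cv x w * Cv y' w)) ∧
    (∀ ν : Fin 3, Summable fun y => (xiOf ℓ k) ^ 3 * (dK1 (xiOf ℓ k) ν Cv y' y * Lker (xiOf ℓ k) μ ν Cv Cv y' y)) ∧
    (∀ ν : Fin 3, Summable fun y => dK1 (xiOf ℓ k) ν Cv y' (y + unitVec μ) * Nker (xiOf ℓ k) ν Cv Cv y' y) ∧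
    (∀ ν : Fin 3, Summable fun y => dK1 (xiOf ℓ k) ν Cv y' y * Nker (xiOf ℓ k) ν Cv Cv y' y) := by
  have hξ := xiOf_pos ℓ k
  have hξ1 := xiOf_le_one ℓ k
  have hδ1 : δ ≤ 1 := hδh.trans (by norm_num)
  obtain ⟨c1, c2, c3, -, c5⟩ := laws_conv hδ hδh hC l7 l8 l9 hCv
  have hA : 0 ≤ (11700 + C) * (xiOf ℓ k)⁻¹ := by positivity
  have hB : 0 ≤ C * (xiOf ℓ k)⁻¹ := by positivity
  exact sbp_hypotheses_of_laws hξ hξ1 hδ hδ1 (K₁ := Cv) (K₂ := Cv) (K₃ := Cv) (μ := μ) (y' := y') (A₁ := C)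
    (A₂ := (11700 + C) * (xiOf ℓ k)⁻¹) (B := C * (xiOf ℓ k)⁻¹) hC hA hB (fun ν y => c1 ν y' y) (c2 μ) c3 (c5 y')

end Laws

/-! ## §2 The three groups -/

section Groups

/-- **GROUP 1 — the difference kernel on the FIRST line** (`(∂_νM)(y′,y)` against `κ(y) = L[G,G₃](y) + L[G,G₃](y − e_μ)`): `κ` has the
law of a propagator at rate `δ/2` (`abs_Lker_le_profile_of_laws`, unit shift `2e`), and gen 9's transposed Fubini bound at rate
`δ/2` gives `Σ_y` summable with `|Σ'_yξ³(∂_νM)(y′,y)κ(y)| ≤ C²·b·(833/(δ/2)³)²`, `b = 4e·1400·C²·(1+2e)`. [cite: Balaban1983Higgs3, (3.38) p.444] -/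
theorem group1_bound (hℓ : 1 ≤ ℓ) (hk : 1 ≤ k) (ha : 0 < a) (hm : 0 ≤ m2) {δ C : ℝ} (hδ : 0 < δ) (hδ1 : δ ≤ 1) (hC : 0 ≤ C)
    (l2 : ∀ (μ : Fin 3) (y z : ZSite 3), |dK1 (xiOf ℓ k) μ (GxiL ℓ k a m2) y z| ≤ C * prof (xiOf ℓ k) δ 2 (y - z))
    (l6 : ∀ (μ : Fin 3) (y z : ZSite 3), |dK1 (xiOf ℓ k) μ (smearG ℓ k a m2) y z| ≤ C * prof (xiOf ℓ k) δ 2 (y - z))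
    (l7 : ∀ u : ZSite 3, |Cxi 3 (xiOf ℓ k) u| ≤ C * prof (xiOf ℓ k) δ 1 u)
    (g1 : ∀ y z : ZSite 3, |GxiL ℓ k a₃ m₃ y z| ≤ C * prof (xiOf ℓ k) δ 1 (y - z))
    (g3 : ∀ (μ : Fin 3) (y z : ZSite 3), |dK2 (xiOf ℓ k) μ (GxiL ℓ k a₃ m₃) y z| ≤ C * prof (xiOf ℓ k) δ 2 (y - z))
    (μ ν : Fin 3) (y' : ZSite 3) :
    Summable (fun y => (xiOf ℓ k) ^ 3 * (dK1 (xiOf ℓ k) ν (MxiL ℓ k a m2) y' y *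
        (Lker (xiOf ℓ k) μ ν (GxiL ℓ k a m2) (GxiL ℓ k a₃ m₃) y' y +
          Lker (xiOf ℓ k) μ ν (GxiL ℓ k a m2) (GxiL ℓ k a₃ m₃) y' (y - unitVec μ)))) ∧
      |∑' y, (xiOf ℓ k) ^ 3 * (dK1 (xiOf ℓ k) ν (MxiL ℓ k a m2) y' y *
          (Lker (xiOf ℓ k) μ ν (GxiL ℓ k a m2) (GxiL ℓ k a₃ m₃) y' y +
            Lker (xiOf ℓ k) μ ν (GxiL ℓ k a m2) (GxiL ℓ k a₃ m₃) y' (y - unitVec μ)))| ≤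
        C * C * (4 * Real.exp 1 * 1400 * C * C * (1 + 2 * Real.exp 1)) * ((833 / (δ / 2) ^ 3) * (833 / (δ / 2) ^ 3)) := by
  have hξ := xiOf_pos ℓ k
  have hξ1 := xiOf_le_one ℓ k
  set ξ := xiOf ℓ k with hξdef
  have hδ' : 0 < δ / 2 := by linarith
  have hδ'1 : δ / 2 ≤ 1 := by linarith
  -- the law of `L[G,G₃]`
  have hB : ∀ w, |GxiL ℓ k a₃ m₃ y' w| ≤ C * ξ⁻¹ := fun w => le_mul_inv_of_le_prof_one hξ hδ.le hC (g1 y' w)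
  have hLaw : ∀ x, |Lker ξ μ ν (GxiL ℓ k a m2) (GxiL ℓ k a₃ m₃) y' x| ≤
      4 * Real.exp 1 * 1400 * C * C * prof ξ (δ / 2) 1 (x - y') := fun x =>
    abs_Lker_le_profile_of_laws hξ hξ1 hδ hδ1 (K₂ := GxiL ℓ k a m2) (K₃ := GxiL ℓ k a₃ m₃) (μ := μ) (ν := ν) (y' := y')
      hC hC (fun x w => l2 μ x w) (fun w => g3 ν y' w) hB x
  -- `κ = L + L(· − e_μ)` has the same law up to the shift factor `2e`
  set b : ℝ := 4 * Real.exp 1 * 1400 * C * C * (1 + 2 * Real.exp 1) with hb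
  have hb0 : 0 ≤ b := by positivity
  have hκ : ∀ y, |Lker ξ μ ν (GxiL ℓ k a m2) (GxiL ℓ k a₃ m₃) y' y +
      Lker ξ μ ν (GxiL ℓ k a m2) (GxiL ℓ k a₃ m₃) y' (y - unitVec μ)| ≤ b * prof ξ (δ / 2) 1 (y - y') := by
    intro y
    have h1 := hLaw y
    have h2 := hLaw (y - unitVec μ)
    have e : y - unitVec μ - y' = y - y' + -unitVec μ := by abel
    rw [e] at h2
    have hsh := prof_shift_le hξ hξ1 hδ'.le hδ'1 1 (y - y') (-unitVec μ) (supNorm_unitVec μ).2.le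
    have hp := prof_nonneg hξ.le (δ / 2) 1 (y - y')
    have h0 : 0 ≤ 4 * Real.exp 1 * 1400 * C * C := by positivity
    refine (abs_add_le _ _).trans ?_
    calc |Lker ξ μ ν (GxiL ℓ k a m2) (GxiL ℓ k a₃ m₃) y' y| +
          |Lker ξ μ ν (GxiL ℓ k a m2) (GxiL ℓ k a₃ m₃) y' (y - unitVec μ)|
        ≤ 4 * Real.exp 1 * 1400 * C * C * prof ξ (δ / 2) 1 (y - y') +
            4 * Real.exp 1 * 1400 * C * C * (2 ^ 1 * Real.exp 1 * prof ξ (δ / 2) 1 (y - y')) :=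
          add_le_add h1 (h2.trans (mul_le_mul_of_nonneg_left hsh h0))
      _ = b * prof ξ (δ / 2) 1 (y - y') := by rw [hb]; ring
  -- the laws of the difference kernel's convolution factors at rate `δ/2`
  have l6' : ∀ (μ : Fin 3) (y z : ZSite 3), |dK1 ξ μ (smearG ℓ k a m2) y z| ≤ C * prof ξ (δ / 2) 2 (y - z) := fun μ y z =>
    (l6 μ y z).trans (mul_le_mul_of_nonneg_left (prof_mono_rate hξ.le (by linarith) 2 _) hC)
  have l7' : ∀ u : ZSite 3, |Cxi 3 ξ u| ≤ C * prof ξ (δ / 2) 1 u := fun u =>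
    (l7 u).trans (mul_le_mul_of_nonneg_left (prof_mono_rate hξ.le (by linarith) 1 _) hC)
  exact fubini_bound_transposed_of_laws hℓ hk ha hm hδ' hδ'1 hC l6' l7' ν y' hb0 hκ

/-- **GROUP 2 — the difference kernel on the MIDDLE line**: `|L[M,G₃](x)| ≤ K·C·833/(δ/2)³` for all `x` (`abs_Lker_le_const_of_laws`
with gen 9's `|∂M∂^*| ≤ K·P₁^{δ/2}`), and the outer sum against `|(∂_νC^ξ)(y′−y)| ≤ CP₂` is `≤ 2·(KC·833/(δ/2)³)·C·833/δ³`.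
[cite: Balaban1983Higgs3, (3.38) p.444] -/
theorem group2_bound {δ C K : ℝ} (hδ : 0 < δ) (hδ1 : δ ≤ 1) (hC : 0 ≤ C) (hK : 0 ≤ K)
    (l9 : ∀ (μ : Fin 3) (u : ZSite 3), |pdiffZ (xiOf ℓ k)⁻¹ μ (Cxi 3 (xiOf ℓ k)) u| ≤ C * prof (xiOf ℓ k) δ 2 u)
    (hd2M : ∀ (μ' μ : Fin 3) (x y : ZSite 3),
      |d2K (xiOf ℓ k) μ' μ (MxiL ℓ k a m2) x y| ≤ K * prof (xiOf ℓ k) (δ / 2) 1 (x - y))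
    (g1 : ∀ y z : ZSite 3, |GxiL ℓ k a₃ m₃ y z| ≤ C * prof (xiOf ℓ k) δ 1 (y - z))
    {Cv : ZSite 3 → ZSite 3 → ℝ} (hCv : Cv = fun p q => Cxi 3 (xiOf ℓ k) (p - q)) (μ ν : Fin 3) (y' : ZSite 3) :
    (∀ x, Summable (fun w => (xiOf ℓ k) ^ 3 * (d2K (xiOf ℓ k) μ ν (MxiL ℓ k a m2) x w * GxiL ℓ k a₃ m₃ y' w)) ∧
      |Lker (xiOf ℓ k) μ ν (MxiL ℓ k a m2) (GxiL ℓ k a₃ m₃) y' x| ≤ K * C * (833 / (δ / 2) ^ 3)) ∧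
    Summable (fun y => (xiOf ℓ k) ^ 3 * (dK1 (xiOf ℓ k) ν Cv y' y *
        (Lker (xiOf ℓ k) μ ν (MxiL ℓ k a m2) (GxiL ℓ k a₃ m₃) y' y +
          Lker (xiOf ℓ k) μ ν (MxiL ℓ k a m2) (GxiL ℓ k a₃ m₃) y' (y - unitVec μ)))) ∧
    |∑' y, (xiOf ℓ k) ^ 3 * (dK1 (xiOf ℓ k) ν Cv y' y *
        (Lker (xiOf ℓ k) μ ν (MxiL ℓ k a m2) (GxiL ℓ k a₃ m₃) y' y +
          Lker (xiOf ℓ k) μ ν (MxiL ℓ k a m2) (GxiL ℓ k a₃ m₃) y' (y - unitVec μ)))| ≤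
      2 * (K * C * (833 / (δ / 2) ^ 3)) * C * (833 / δ ^ 3) := by
  have hξ := xiOf_pos ℓ k
  have hξ1 := xiOf_le_one ℓ k
  have hdK1 : ∀ y, |dK1 (xiOf ℓ k) ν Cv y' y| ≤ C * prof (xiOf ℓ k) δ 2 (y' - y) := by
    intro y; subst hCv; rw [dK1_conv]; exact l9 ν (y' - y)
  set ξ := xiOf ℓ k with hξdef
  have hδ' : 0 < δ / 2 := by linarith
  have hδ'1 : δ / 2 ≤ 1 := by linarith
  have g1' : ∀ w, |GxiL ℓ k a₃ m₃ y' w| ≤ C * prof ξ (δ / 2) 1 (y' - w) := fun w =>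
    (g1 y' w).trans (mul_le_mul_of_nonneg_left (prof_mono_rate hξ.le (by linarith) 1 _) hC)
  have hL := fun x => abs_Lker_le_const_of_laws hξ hξ1 hδ' hδ'1 (K₂ := MxiL ℓ k a m2) (K₃ := GxiL ℓ k a₃ m₃) (μ := μ)
    (ν := ν) (y' := y') hK hC (hd2M μ ν) g1' x
  set c₂ : ℝ := K * C * (833 / (δ / 2) ^ 3) with hc₂
  have hc₂0 : 0 ≤ c₂ := by positivity
  have hdom : ∀ y, |ξ ^ 3 * (dK1 ξ ν Cv y' y *
      (Lker ξ μ ν (MxiL ℓ k a m2) (GxiL ℓ k a₃ m₃) y' y + Lker ξ μ ν (MxiL ℓ k a m2) (GxiL ℓ k a₃ m₃) y' (y - unitVec μ)))| ≤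
      2 * c₂ * C * (ξ ^ 3 * prof ξ δ 2 (y' - y)) := by
    intro y
    rw [abs_mul, abs_of_pos (pow_pos hξ 3), abs_mul]
    have hp := prof_nonneg hξ.le δ 2 (y' - y)
    have hs : |Lker ξ μ ν (MxiL ℓ k a m2) (GxiL ℓ k a₃ m₃) y' y +
        Lker ξ μ ν (MxiL ℓ k a m2) (GxiL ℓ k a₃ m₃) y' (y - unitVec μ)| ≤ 2 * c₂ :=
      (abs_add_le _ _).trans (by linarith [(hL y).2, (hL (y - unitVec μ)).2])
    calc ξ ^ 3 * (|dK1 ξ ν Cv y' y| * |Lker ξ μ ν (MxiL ℓ k a m2) (GxiL ℓ k a₃ m₃) y' y +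
            Lker ξ μ ν (MxiL ℓ k a m2) (GxiL ℓ k a₃ m₃) y' (y - unitVec μ)|)
        ≤ ξ ^ 3 * (C * prof ξ δ 2 (y' - y) * (2 * c₂)) :=
          mul_le_mul_of_nonneg_left (mul_le_mul (hdK1 y) hs (abs_nonneg _) (by positivity)) (pow_pos hξ 3).le
      _ = 2 * c₂ * C * (ξ ^ 3 * prof ξ δ 2 (y' - y)) := by ring
  obtain ⟨hsP, hbP⟩ := prof_summable_left hξ hξ1 hδ hδ1 (le_refl 2) y'
  have hs := summable_of_le_prof_left hξ hξ1 hδ hδ1 (le_refl 2) y' hdom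
  refine ⟨hL, hs, (abs_tsum_le_tsum_of_abs_le hs (hsP.mul_left _) hdom).trans ?_⟩
  rw [tsum_mul_left]
  calc 2 * c₂ * C * ∑' y, ξ ^ 3 * prof ξ δ 2 (y' - y) ≤ 2 * c₂ * C * (833 / δ ^ 3) :=
        mul_le_mul_of_nonneg_left hbP (by positivity)
    _ = 2 * (K * C * (833 / (δ / 2) ^ 3)) * C * (833 / δ ^ 3) := by rw [hc₂]

/-- **GROUP 3 — the difference kernel on the LAST line**: `|L[C^ξ,M₃](x)| ≤ C³·1400·833/(δ/2)³` for all `x` (`abs_Lker_conv_M_le_const`: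
the backward difference falls on the `C^ξ` inside `M₃`), and the outer sum against `|(∂_νC^ξ)(y′−y)| ≤ CP₂` is
`≤ 2·(C³·1400·833/(δ/2)³)·C·833/δ³`. [cite: Balaban1983Higgs3, (3.38) p.444] -/
theorem group3_bound (hℓ : 1 ≤ ℓ) (hk : 1 ≤ k) (ha₃ : 0 < a₃) (hm₃ : 0 ≤ m₃) {δ C K : ℝ} (hδ : 0 < δ) (hδ1 : δ ≤ 1)
    (hC : 0 ≤ C)
    (l9 : ∀ (μ : Fin 3) (u : ZSite 3), |pdiffZ (xiOf ℓ k)⁻¹ μ (Cxi 3 (xiOf ℓ k)) u| ≤ C * prof (xiOf ℓ k) δ 2 u)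
    (g5 : ∀ y z : ZSite 3, |smearG ℓ k a₃ m₃ y z| ≤ C * prof (xiOf ℓ k) δ 1 (y - z))
    (hM3 : ∀ y w : ZSite 3, |MxiL ℓ k a₃ m₃ y w| ≤ K)
    {Cv : ZSite 3 → ZSite 3 → ℝ} (hCv : Cv = fun p q => Cxi 3 (xiOf ℓ k) (p - q)) (μ ν : Fin 3) (y' : ZSite 3) :
    (∀ x, |Lker (xiOf ℓ k) μ ν Cv (MxiL ℓ k a₃ m₃) y' x| ≤ C * (C * C) * 1400 * (833 / (δ / 2) ^ 3)) ∧
    Summable (fun y => (xiOf ℓ k) ^ 3 * (dK1 (xiOf ℓ k) ν Cv y' y *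
        (Lker (xiOf ℓ k) μ ν Cv (MxiL ℓ k a₃ m₃) y' y + Lker (xiOf ℓ k) μ ν Cv (MxiL ℓ k a₃ m₃) y' (y - unitVec μ)))) ∧
    |∑' y, (xiOf ℓ k) ^ 3 * (dK1 (xiOf ℓ k) ν Cv y' y *
        (Lker (xiOf ℓ k) μ ν Cv (MxiL ℓ k a₃ m₃) y' y + Lker (xiOf ℓ k) μ ν Cv (MxiL ℓ k a₃ m₃) y' (y - unitVec μ)))| ≤
      2 * (C * (C * C) * 1400 * (833 / (δ / 2) ^ 3)) * C * (833 / δ ^ 3) := by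
  have hξ := xiOf_pos ℓ k
  have hξ1 := xiOf_le_one ℓ k
  have hdK1 : ∀ y, |dK1 (xiOf ℓ k) ν Cv y' y| ≤ C * prof (xiOf ℓ k) δ 2 (y' - y) := by
    intro y; subst hCv; rw [dK1_conv]; exact l9 ν (y' - y)
  have hL : ∀ x, |Lker (xiOf ℓ k) μ ν Cv (MxiL ℓ k a₃ m₃) y' x| ≤ C * (C * C) * 1400 * (833 / (δ / 2) ^ 3) := by
    intro x; subst hCv
    exact abs_Lker_conv_M_le_const hℓ hk ha₃ hm₃ hδ hδ1 hC hC g5 l9 hM3 (K := Cxi 3 (xiOf ℓ k)) l9 μ ν y' x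
  set ξ := xiOf ℓ k with hξdef
  set c₃ : ℝ := C * (C * C) * 1400 * (833 / (δ / 2) ^ 3) with hc₃
  have hc₃0 : 0 ≤ c₃ := by positivity
  have hdom : ∀ y, |ξ ^ 3 * (dK1 ξ ν Cv y' y *
      (Lker ξ μ ν Cv (MxiL ℓ k a₃ m₃) y' y + Lker ξ μ ν Cv (MxiL ℓ k a₃ m₃) y' (y - unitVec μ)))| ≤
      2 * c₃ * C * (ξ ^ 3 * prof ξ δ 2 (y' - y)) := by
    intro y
    rw [abs_mul, abs_of_pos (pow_pos hξ 3), abs_mul]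
    have hp := prof_nonneg hξ.le δ 2 (y' - y)
    have hs : |Lker ξ μ ν Cv (MxiL ℓ k a₃ m₃) y' y + Lker ξ μ ν Cv (MxiL ℓ k a₃ m₃) y' (y - unitVec μ)| ≤ 2 * c₃ :=
      (abs_add_le _ _).trans (by linarith [hL y, hL (y - unitVec μ)])
    calc ξ ^ 3 * (|dK1 ξ ν Cv y' y| *
          |Lker ξ μ ν Cv (MxiL ℓ k a₃ m₃) y' y + Lker ξ μ ν Cv (MxiL ℓ k a₃ m₃) y' (y - unitVec μ)|)
        ≤ ξ ^ 3 * (C * prof ξ δ 2 (y' - y) * (2 * c₃)) :=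
          mul_le_mul_of_nonneg_left (mul_le_mul (hdK1 y) hs (abs_nonneg _) (by positivity)) (pow_pos hξ 3).le
      _ = 2 * c₃ * C * (ξ ^ 3 * prof ξ δ 2 (y' - y)) := by ring
  obtain ⟨hsP, hbP⟩ := prof_summable_left hξ hξ1 hδ hδ1 (le_refl 2) y'
  have hs := summable_of_le_prof_left hξ hξ1 hδ hδ1 (le_refl 2) y' hdom
  refine ⟨hL, hs, (abs_tsum_le_tsum_of_abs_le hs (hsP.mul_left _) hdom).trans ?_⟩
  rw [tsum_mul_left]
  calc 2 * c₃ * C * ∑' y, ξ ^ 3 * prof ξ δ 2 (y' - y) ≤ 2 * c₃ * C * (833 / δ ^ 3) :=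
        mul_le_mul_of_nonneg_left hbP (by positivity)
    _ = 2 * (C * (C * C) * 1400 * (833 / (δ / 2) ^ 3)) * C * (833 / δ ^ 3) := by rw [hc₃]

/-- **THE POINTWISE SPLIT** `G = Cv + M` on the first line, then on the middle line, then `G₃ = Cv + M₃` on the last line (model-free,
for kernels whose `L`-series converge): integrand[G,G,G₃] − integrand[Cv,Cv,Cv] = (`M` on the first line, `G,G₃` kept) + (`Cv, M,
G₃`) + (`Cv, Cv, M₃`). [cite: Balaban1983Higgs3, (3.38) p.444] -/
theorem integrand_split (ξ : ℝ) (μ ν : Fin 3) {Cv M M₃ G G₃ : ZSite 3 → ZSite 3 → ℝ}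
    (hG : G = fun p q => Cv p q + M p q) (hG₃ : G₃ = fun p q => Cv p q + M₃ p q) (y' y : ZSite 3)
    (hsC : ∀ x, Summable fun w => ξ ^ 3 * (d2K ξ μ ν Cv x w * G₃ y' w))
    (hsM : ∀ x, Summable fun w => ξ ^ 3 * (d2K ξ μ ν M x w * G₃ y' w))
    (hsCC : ∀ x, Summable fun w => ξ ^ 3 * (d2K ξ μ ν Cv x w * Cv y' w))
    (hsCM : ∀ x, Summable fun w => ξ ^ 3 * (d2K ξ μ ν Cv x w * M₃ y' w)) :
    ξ ^ 3 * (dK1 ξ ν G y' y * (Lker ξ μ ν G G₃ y' y + Lker ξ μ ν G G₃ y' (y - unitVec μ))) -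
        ξ ^ 3 * (dK1 ξ ν Cv y' y * (Lker ξ μ ν Cv Cv y' y + Lker ξ μ ν Cv Cv y' (y - unitVec μ))) =
      ξ ^ 3 * (dK1 ξ ν M y' y * (Lker ξ μ ν G G₃ y' y + Lker ξ μ ν G G₃ y' (y - unitVec μ))) +
        ξ ^ 3 * (dK1 ξ ν Cv y' y * (Lker ξ μ ν M G₃ y' y + Lker ξ μ ν M G₃ y' (y - unitVec μ))) +
        ξ ^ 3 * (dK1 ξ ν Cv y' y * (Lker ξ μ ν Cv M₃ y' y + Lker ξ μ ν Cv M₃ y' (y - unitVec μ))) := by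
  have h1 : dK1 ξ ν G y' y = dK1 ξ ν Cv y' y + dK1 ξ ν M y' y := by rw [hG]; exact dK1_add ξ ν Cv M y' y
  have h2 : ∀ x, Lker ξ μ ν G G₃ y' x = Lker ξ μ ν Cv G₃ y' x + Lker ξ μ ν M G₃ y' x := fun x => by
    rw [hG]; exact Lker_add_mid x (hsC x) (hsM x)
  have h3 : ∀ x, Lker ξ μ ν Cv G₃ y' x = Lker ξ μ ν Cv Cv y' x + Lker ξ μ ν Cv M₃ y' x := fun x => by
    have hc := hsCC x
    have hm := hsCM x
    subst hG₃
    exact Lker_add_right x hc hm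
  rw [h1, h2 y, h2 (y - unitVec μ), h3 y, h3 (y - unitVec μ)]
  ring

end Groups

/-! ## §3 The assembly -/

section Assembly

/-- **THE CORE ESTIMATE** at fixed `k`, parameters and laws: `T[G,G,G₃] = sbpForm[G,G,G₃]`, `T[Cv,Cv,Cv] = sbpForm[Cv,Cv,Cv]`, and
`|sbpForm[G,G,G₃](y′) − sbpForm[Cv,Cv,Cv](y′)| ≤ 3(O₁ + O₂ + O₃)|q³|` with the three group constants. [cite: Balaban1983Higgs3, (3.38) p.444] -/
theorem sbpForm_sub_bound (hℓ : 1 ≤ ℓ) (hk : 1 ≤ k) (ha : 0 < a) (hm : 0 ≤ m2) (ha₃ : 0 < a₃) (hm₃ : 0 ≤ m₃)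
    {δ C K : ℝ} (hδ : 0 < δ) (hδh : δ ≤ 1 / 2) (hC : 0 ≤ C) (hK : 0 ≤ K)
    (l2 : ∀ (μ : Fin 3) (y z : ZSite 3), |dK1 (xiOf ℓ k) μ (GxiL ℓ k a m2) y z| ≤ C * prof (xiOf ℓ k) δ 2 (y - z))
    (l3 : ∀ (μ : Fin 3) (y z : ZSite 3), |dK2 (xiOf ℓ k) μ (GxiL ℓ k a m2) y z| ≤ C * prof (xiOf ℓ k) δ 2 (y - z))
    (l4 : ∀ (μ' μ : Fin 3) (x y : ZSite 3), |d2K (xiOf ℓ k) μ' μ (GxiL ℓ k a m2) x y| ≤ C * prof (xiOf ℓ k) δ 3 (x - y))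
    (l6 : ∀ (μ : Fin 3) (y z : ZSite 3), |dK1 (xiOf ℓ k) μ (smearG ℓ k a m2) y z| ≤ C * prof (xiOf ℓ k) δ 2 (y - z))
    (l7 : ∀ u : ZSite 3, |Cxi 3 (xiOf ℓ k) u| ≤ C * prof (xiOf ℓ k) δ 1 u)
    (l8 : ∀ (μ : Fin 3) (u : ZSite 3), |pdiffAdjZ (xiOf ℓ k)⁻¹ μ (Cxi 3 (xiOf ℓ k)) u| ≤ C * prof (xiOf ℓ k) δ 2 u)
    (l9 : ∀ (μ : Fin 3) (u : ZSite 3), |pdiffZ (xiOf ℓ k)⁻¹ μ (Cxi 3 (xiOf ℓ k)) u| ≤ C * prof (xiOf ℓ k) δ 2 u)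
    (hd2M : ∀ (μ' μ : Fin 3) (x y : ZSite 3),
      |d2K (xiOf ℓ k) μ' μ (MxiL ℓ k a m2) x y| ≤ K * prof (xiOf ℓ k) (δ / 2) 1 (x - y))
    (g1 : ∀ y z : ZSite 3, |GxiL ℓ k a₃ m₃ y z| ≤ C * prof (xiOf ℓ k) δ 1 (y - z))
    (g3 : ∀ (μ : Fin 3) (y z : ZSite 3), |dK2 (xiOf ℓ k) μ (GxiL ℓ k a₃ m₃) y z| ≤ C * prof (xiOf ℓ k) δ 2 (y - z))
    (g5 : ∀ y z : ZSite 3, |smearG ℓ k a₃ m₃ y z| ≤ C * prof (xiOf ℓ k) δ 1 (y - z))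
    (hM3 : ∀ y w : ZSite 3, |MxiL ℓ k a₃ m₃ y w| ≤ K)
    {Cv : ZSite 3 → ZSite 3 → ℝ} (hCv : Cv = fun p q => Cxi 3 (xiOf ℓ k) (p - q)) (q3 : ℝ) (μ : Fin 3) (y' : ZSite 3) :
    tri20 (xiOf ℓ k) q3 μ (GxiL ℓ k a m2) (GxiL ℓ k a m2) (GxiL ℓ k a₃ m₃) y' =
        sbpForm (xiOf ℓ k) q3 μ (GxiL ℓ k a m2) (GxiL ℓ k a m2) (GxiL ℓ k a₃ m₃) y' ∧
      tri20 (xiOf ℓ k) q3 μ Cv Cv Cv y' = sbpForm (xiOf ℓ k) q3 μ Cv Cv Cv y' ∧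
      |sbpForm (xiOf ℓ k) q3 μ (GxiL ℓ k a m2) (GxiL ℓ k a m2) (GxiL ℓ k a₃ m₃) y' - sbpForm (xiOf ℓ k) q3 μ Cv Cv Cv y'| ≤
        3 * (C * C * (4 * Real.exp 1 * 1400 * C * C * (1 + 2 * Real.exp 1)) * ((833 / (δ / 2) ^ 3) * (833 / (δ / 2) ^ 3)) +
          2 * (K * C * (833 / (δ / 2) ^ 3)) * C * (833 / δ ^ 3) +
          2 * (C * (C * C) * 1400 * (833 / (δ / 2) ^ 3)) * C * (833 / δ ^ 3)) * |q3| := by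
  have hξ := xiOf_pos ℓ k
  have hξ1 := xiOf_le_one ℓ k
  have hδ1 : δ ≤ 1 := hδh.trans (by norm_num)
  -- the summation-by-parts hypotheses and identities for both triples
  obtain ⟨hLG, hNG, hAG, hB1G, hB2G⟩ := sbp_hypotheses_G (a₃ := a₃) (m₃ := m₃) hδ hδ1 hC l2 l3 l4 g1 μ y'
  obtain ⟨hLC, hNC, hAC, hB1C, hB2C⟩ := sbp_hypotheses_conv hδ hδh hC l7 l8 l9 hCv μ y'
  have eG := tri20_eq_sbpForm hξ.ne' q3 hLG hNG hAG hB1G hB2G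
  have eC := tri20_eq_sbpForm hξ.ne' q3 hLC hNC hAC hB1C hB2C
  -- the three groups
  have G1 := fun ν => group1_bound hℓ hk ha hm hδ hδ1 hC l2 l6 l7 g1 g3 μ ν y'
  have G2 := fun ν => group2_bound (a := a) (m2 := m2) hδ hδ1 hC hK l9 hd2M g1 hCv μ ν y'
  have G3 := fun ν => group3_bound hℓ hk ha₃ hm₃ hδ hδ1 hC l9 g5 hM3 hCv μ ν y'
  -- the summabilities of the split: `(Cv, G₃)` and `(Cv, M₃)`
  obtain ⟨-, c2, -, -, c5⟩ := laws_conv hδ hδh hC l7 l8 l9 hCv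
  have hA : 0 ≤ (11700 + C) * (xiOf ℓ k)⁻¹ := by positivity
  have hG₃b : ∀ w, |GxiL ℓ k a₃ m₃ y' w| ≤ C * (xiOf ℓ k)⁻¹ := fun w => le_mul_inv_of_le_prof_one hξ hδ.le hC (g1 y' w)
  have hsCG : ∀ (ν : Fin 3) (x : ZSite 3),
      Summable fun w => (xiOf ℓ k) ^ 3 * (d2K (xiOf ℓ k) μ ν Cv x w * GxiL ℓ k a₃ m₃ y' w) := fun ν x =>
    (abs_Lker_le_crude hξ hξ1 hδ hδ1 (K₂ := Cv) (K₃ := GxiL ℓ k a₃ m₃) (μ := μ) (ν := ν) (y' := y') hA (by positivity)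
      (c2 μ ν) hG₃b x).1
  have hsCM : ∀ (ν : Fin 3) (x : ZSite 3),
      Summable fun w => (xiOf ℓ k) ^ 3 * (d2K (xiOf ℓ k) μ ν Cv x w * MxiL ℓ k a₃ m₃ y' w) := fun ν x =>
    (abs_Lker_le_crude hξ hξ1 hδ hδ1 (K₂ := Cv) (K₃ := MxiL ℓ k a₃ m₃) (μ := μ) (ν := ν) (y' := y') hA hK
      (c2 μ ν) (hM3 y') x).1
  -- the pointwise split
  have hsplit := fun ν y => integrand_split (xiOf ℓ k) μ ν (GxiL_eq_add_M hCv a m2) (GxiL_eq_add_M hCv a₃ m₃) y' y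
    (hsCG ν) (fun x => ((G2 ν).1 x).1) (hLC ν) (hsCM ν)
  -- the summable integrands of the two forms
  have hIG : ∀ ν : Fin 3, Summable fun y => (xiOf ℓ k) ^ 3 * (dK1 (xiOf ℓ k) ν (GxiL ℓ k a m2) y' y *
      (Lker (xiOf ℓ k) μ ν (GxiL ℓ k a m2) (GxiL ℓ k a₃ m₃) y' y +
        Lker (xiOf ℓ k) μ ν (GxiL ℓ k a m2) (GxiL ℓ k a₃ m₃) y' (y - unitVec μ))) := fun ν =>
    ((hAG ν).add (summable_dK1_mul_Lker_shift hξ.ne' (hNG ν) (hB1G ν) (hB2G ν))).congr fun y => by ring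
  have hIC : ∀ ν : Fin 3, Summable fun y => (xiOf ℓ k) ^ 3 * (dK1 (xiOf ℓ k) ν Cv y' y *
      (Lker (xiOf ℓ k) μ ν Cv Cv y' y + Lker (xiOf ℓ k) μ ν Cv Cv y' (y - unitVec μ))) := fun ν =>
    ((hAC ν).add (summable_dK1_mul_Lker_shift hξ.ne' (hNC ν) (hB1C ν) (hB2C ν))).congr fun y => by ring
  refine ⟨eG, eC, ?_⟩
  set ξ := xiOf ℓ k with hξdef
  -- the difference of the two forms, group by group
  have key : ∀ ν : Fin 3,
      ∑' y, ξ ^ 3 * (dK1 ξ ν (GxiL ℓ k a m2) y' y *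
          (Lker ξ μ ν (GxiL ℓ k a m2) (GxiL ℓ k a₃ m₃) y' y +
            Lker ξ μ ν (GxiL ℓ k a m2) (GxiL ℓ k a₃ m₃) y' (y - unitVec μ))) -
        ∑' y, ξ ^ 3 * (dK1 ξ ν Cv y' y * (Lker ξ μ ν Cv Cv y' y + Lker ξ μ ν Cv Cv y' (y - unitVec μ))) =
      ∑' y, ξ ^ 3 * (dK1 ξ ν (MxiL ℓ k a m2) y' y *
          (Lker ξ μ ν (GxiL ℓ k a m2) (GxiL ℓ k a₃ m₃) y' y +
            Lker ξ μ ν (GxiL ℓ k a m2) (GxiL ℓ k a₃ m₃) y' (y - unitVec μ))) +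
        ∑' y, ξ ^ 3 * (dK1 ξ ν Cv y' y *
          (Lker ξ μ ν (MxiL ℓ k a m2) (GxiL ℓ k a₃ m₃) y' y +
            Lker ξ μ ν (MxiL ℓ k a m2) (GxiL ℓ k a₃ m₃) y' (y - unitVec μ))) +
        ∑' y, ξ ^ 3 * (dK1 ξ ν Cv y' y *
          (Lker ξ μ ν Cv (MxiL ℓ k a₃ m₃) y' y + Lker ξ μ ν Cv (MxiL ℓ k a₃ m₃) y' (y - unitVec μ))) := by
    intro ν
    rw [← (hIG ν).tsum_sub (hIC ν), tsum_congr (hsplit ν), ((G1 ν).1.add (G2 ν).2.1).tsum_add (G3 ν).2.1,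
      (G1 ν).1.tsum_add (G2 ν).2.1]
  have hdiff : sbpForm ξ q3 μ (GxiL ℓ k a m2) (GxiL ℓ k a m2) (GxiL ℓ k a₃ m₃) y' - sbpForm ξ q3 μ Cv Cv Cv y' =
      -q3 * ∑ ν : Fin 3,
        (∑' y, ξ ^ 3 * (dK1 ξ ν (MxiL ℓ k a m2) y' y *
            (Lker ξ μ ν (GxiL ℓ k a m2) (GxiL ℓ k a₃ m₃) y' y +
              Lker ξ μ ν (GxiL ℓ k a m2) (GxiL ℓ k a₃ m₃) y' (y - unitVec μ))) +
          ∑' y, ξ ^ 3 * (dK1 ξ ν Cv y' y *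
            (Lker ξ μ ν (MxiL ℓ k a m2) (GxiL ℓ k a₃ m₃) y' y +
              Lker ξ μ ν (MxiL ℓ k a m2) (GxiL ℓ k a₃ m₃) y' (y - unitVec μ))) +
          ∑' y, ξ ^ 3 * (dK1 ξ ν Cv y' y *
            (Lker ξ μ ν Cv (MxiL ℓ k a₃ m₃) y' y + Lker ξ μ ν Cv (MxiL ℓ k a₃ m₃) y' (y - unitVec μ)))) := by
    unfold sbpForm
    rw [← mul_sub, ← Finset.sum_sub_distrib]
    congr 1
    exact Finset.sum_congr rfl fun ν _ => key ν
  rw [hdiff, abs_mul, abs_neg]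
  have hsum := (Finset.abs_sum_le_sum_abs _ _).trans (Finset.sum_le_sum fun ν (_ : ν ∈ (Finset.univ : Finset (Fin 3))) =>
    (abs_add_three _ _ _).trans (add_le_add_three (G1 ν).2 (G2 ν).2.2 (G3 ν).2.2))
  rw [Finset.sum_const, Finset.card_univ, Fintype.card_fin, nsmul_eq_mul, Nat.cast_ofNat] at hsum
  rw [mul_comm]
  exact mul_le_mul_of_nonneg_right hsum (abs_nonneg q3)

/-- **THE p. 444 REPLACEMENT SENTENCE FOR THE GRAPHS (2.20), (3.38), ON THE PRINTED INFINITE LATTICE ξℤ³** (zero field, `d = 3`;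
MODEL INSTANCE: the three lines are p03's infinite-lattice propagator rescaled, the scalar lines `G_{j₀}(0)` with `(a, m²)` and the
vector line with `(a₃, m₃²)`, each in the window): there is `Cst > 0` such that for all `k ≥ 1`, all parameters in the window, all
`q³`, `μ`, `y′`: (i) the triangle factor equals its summation-by-parts form (all its series converge); (ii) *"we get a convergent
expression"* — `|T[G,G,G₃](y′) − T[C^ξ,C^ξ,C^ξ](y′)| ≤ Cst·|q³|` UNIFORMLY in the spacing and the position; (iii) *"for the graphs
(2.20) it equals [(3.38)] = 0"* — `T[C^ξ,C^ξ,C^ξ](y′) = 0`; (iv) hence `|T[G,G,G₃](y′)| ≤ Cst·|q³|`: the (3.36) vertex coefficient of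
the graphs (2.20) is bounded uniformly. [cite: Balaban1983Higgs3, (3.38) p.444] -/
theorem exists_tri20_bound (hℓ : 1 ≤ ℓ) (amin aplus m2plus : ℝ) (ha : 0 < amin) :
    ∃ Cst : ℝ, 0 < Cst ∧ ∀ (k : ℕ), 1 ≤ k → ∀ (a m2 a₃ m₃ : ℝ), amin ≤ a → a ≤ aplus → 0 ≤ m2 → m2 ≤ m2plus →
      amin ≤ a₃ → a₃ ≤ aplus → 0 ≤ m₃ → m₃ ≤ m2plus → ∀ (q3 : ℝ) (μ : Fin 3) (y' : ZSite 3),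
      tri20 (xiOf ℓ k) q3 μ (GxiL ℓ k a m2) (GxiL ℓ k a m2) (GxiL ℓ k a₃ m₃) y' =
          sbpForm (xiOf ℓ k) q3 μ (GxiL ℓ k a m2) (GxiL ℓ k a m2) (GxiL ℓ k a₃ m₃) y' ∧
        |tri20 (xiOf ℓ k) q3 μ (GxiL ℓ k a m2) (GxiL ℓ k a m2) (GxiL ℓ k a₃ m₃) y' -
            tri20 (xiOf ℓ k) q3 μ (fun p q => Cxi 3 (xiOf ℓ k) (p - q)) (fun p q => Cxi 3 (xiOf ℓ k) (p - q))
              (fun p q => Cxi 3 (xiOf ℓ k) (p - q)) y'| ≤ Cst * |q3| ∧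
        tri20 (xiOf ℓ k) q3 μ (fun p q => Cxi 3 (xiOf ℓ k) (p - q)) (fun p q => Cxi 3 (xiOf ℓ k) (p - q))
            (fun p q => Cxi 3 (xiOf ℓ k) (p - q)) y' = 0 ∧
        |tri20 (xiOf ℓ k) q3 μ (GxiL ℓ k a m2) (GxiL ℓ k a m2) (GxiL ℓ k a₃ m₃) y'| ≤ Cst * |q3| := by
  obtain ⟨δ, C, K, hδ, hδh, hC1, hK, H⟩ := exists_bounds hℓ amin aplus m2plus ha
  have hC : 0 ≤ C := le_trans (by norm_num) hC1
  have hδ' : 0 < δ / 2 := by linarith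
  set O : ℝ := C * C * (4 * Real.exp 1 * 1400 * C * C * (1 + 2 * Real.exp 1)) * ((833 / (δ / 2) ^ 3) * (833 / (δ / 2) ^ 3)) +
    2 * (K * C * (833 / (δ / 2) ^ 3)) * C * (833 / δ ^ 3) +
    2 * (C * (C * C) * 1400 * (833 / (δ / 2) ^ 3)) * C * (833 / δ ^ 3) with hO
  have hO0 : 0 ≤ O := by positivity
  refine ⟨3 * O + 1, by positivity, ?_⟩
  intro k hk a m2 a₃ m₃ ha1 ha2 hm1 hm2 hb1 hb2 hn1 hn2 q3 μ y'
  have ha0 : 0 < a := lt_of_lt_of_le ha ha1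
  have hb0 : 0 < a₃ := lt_of_lt_of_le ha hb1
  obtain ⟨⟨-, l2, l3, l4, -, l6, l7, l8, l9⟩, -, hd2M, -, -, -, -⟩ := H k hk a m2 ha1 ha2 hm1 hm2
  obtain ⟨⟨g1, -, g3, -, g5, -, -, -, -⟩, hM3, -, -, -, -, -⟩ := H k hk a₃ m₃ hb1 hb2 hn1 hn2
  have hξ := xiOf_pos ℓ k
  obtain ⟨eG, eC, hd⟩ := sbpForm_sub_bound hℓ hk ha0 hm1 hb0 hn1 hδ hδh hC hK.le l2 l3 l4 l6 l7 l8 l9 hd2M g1 g3 g5 hM3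
    (Cv := fun p q => Cxi 3 (xiOf ℓ k) (p - q)) rfl q3 μ y'
  have h0 : tri20 (xiOf ℓ k) q3 μ (fun p q => Cxi 3 (xiOf ℓ k) (p - q)) (fun p q => Cxi 3 (xiOf ℓ k) (p - q))
      (fun p q => Cxi 3 (xiOf ℓ k) (p - q)) y' = 0 := tri20_conv_Cxi hξ q3 μ y'
  have hii : |tri20 (xiOf ℓ k) q3 μ (GxiL ℓ k a m2) (GxiL ℓ k a m2) (GxiL ℓ k a₃ m₃) y' -
      tri20 (xiOf ℓ k) q3 μ (fun p q => Cxi 3 (xiOf ℓ k) (p - q)) (fun p q => Cxi 3 (xiOf ℓ k) (p - q))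
        (fun p q => Cxi 3 (xiOf ℓ k) (p - q)) y'| ≤ (3 * O + 1) * |q3| := by
    rw [eG, eC]
    refine hd.trans ?_
    rw [← hO]
    exact mul_le_mul_of_nonneg_right (by linarith) (abs_nonneg q3)
  refine ⟨eG, hii, h0, ?_⟩
  rw [h0, sub_zero] at hii
  exact hii

end Assembly

end

end Literature.MathematicalPhysics.QuantumFieldTheory.Balaban1983to89.B3Eq338ZeroLattice
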